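import Mathlib
import Literature.Computability.Complexity.RangeAvoidance
import Summits.PneNP.PneNP.Theorems.PstarPairwise
import Summits.PneNP.PneNP.Theorems.PairwiseSALevel
import Summits.PneNP.PneNP.Theorems.AffineAndLaws

/-!
# AND-pair laws over a 2-wise-uniform pattern set: mass, marginals, pairwise independence (cell `pnp-ideate`, ROUND-22, B1 core)

FRONTIER range-avoidance ladder, rung F-N3 context (restricted-model lower bounds; nothing here bears on `P` vs `NP`).
Part 2 of `AffineAndLaws`: for a bias `r` with `2r² = 1` and a non-empty pattern set `𝒜 ⊆ {0,1}^E`, the law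
`andLaw r 𝒜 u = (2^E/|𝒜|)·∏_s ρ_r(u_s)·[andVec u ∈ 𝒜]` on `Fin (E + E) → Bool` satisfies
* `andLaw_total`: total mass `1` (needs `𝒜` 1-wise uniform at one coordinate);
* `marg1_andLaw`: every slot marginal is `ρ_r` (`𝒜` 1-wise uniform);
* `marg2_andLaw`: distinct slots are independent, `marg2 = ρ_r(β)·ρ_r(β')` (`𝒜` 1-wise uniform for the two slots of one
  pair, 2-wise uniform across pairs).
Engine: the two MASTER IDENTITIES `sum_andLaw_mul_one` / `sum_andLaw_mul_two` — the law integrated against a function of one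
pair (resp. of two different pairs) equals the plain `r`-product pair integral (resp. the product of the two), by the Fubini
lemma `sum_andVec_prod`, the fair AND-fibres `fibre_sum_piW` (`2r² = 1`) and `sum_one_coord` / `sum_two_coord`.
-/

set_option linter.dupNamespace false

open Finset
open Summit.PneNP.PneNP.Theorems.PstarPairwise (rho)
open Summit.PneNP.PneNP.Theorems.PairwiseSALevel (marg1 marg2)
open Summit.PneNP.PneNP.Theorems.AffineAndLaws

namespace Summit.PneNP.PneNP.Theorems.AffineAndLawsMarginals

variable {E : ℕ}

/-! ## The pair weight and its AND-fibres -/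

/-- The `r`-product weight of one pair. -/
noncomputable def piW (r : ℝ) (x : Bool × Bool) : ℝ := rho r x.1 * rho r x.2

/-- Each AND-fibre of the pair weight has mass `½` when `2r² = 1`. -/
theorem fibre_sum_piW {r : ℝ} (hr : 2 * r ^ 2 = 1) (τ : Bool) :
    ∑ x ∈ univ.filter (fun x : Bool × Bool => (x.1 && x.2) = τ), piW r x = 1 / 2 := by
  cases τ
  · rw [sum_fibre_false]; simp [piW, rho]; nlinarith [hr]
  · rw [sum_fibre_true]; simp [piW, rho]; nlinarith [hr]

/-- The two AND-fibres of `piW·f` add up to the full pair sum. -/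
theorem fibre_sum_add (r : ℝ) (f : Bool × Bool → ℝ) :
    (∑ x ∈ univ.filter (fun x : Bool × Bool => (x.1 && x.2) = true), piW r x * f x) +
      ∑ x ∈ univ.filter (fun x : Bool × Bool => (x.1 && x.2) = false), piW r x * f x = ∑ x, piW r x * f x := by
  rw [sum_fibre_true, sum_fibre_false]
  simp [Fintype.sum_prod_type]
  ring

/-- A product over `Fin E` with one special factor. -/
theorem prod_ite_one (e₀ : Fin E) (a b : ℝ) : ∏ e : Fin E, (if e = e₀ then a else b) = a * b ^ (E - 1) := by
  classical
  rw [← Finset.mul_prod_erase univ _ (Finset.mem_univ e₀), if_pos rfl]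
  congr 1
  rw [Finset.prod_congr rfl (fun e he => if_neg (Finset.ne_of_mem_erase he)), Finset.prod_const, Finset.card_erase_of_mem
    (Finset.mem_univ _), Finset.card_univ, Fintype.card_fin]

/-- A product over `Fin E` with two special factors. -/
theorem prod_ite_two {e₀ e₁ : Fin E} (hne : e₀ ≠ e₁) (a a' b : ℝ) :
    ∏ e : Fin E, (if e = e₀ then a else if e = e₁ then a' else b) = a * a' * b ^ (E - 2) := by
  classical
  rw [← Finset.mul_prod_erase univ _ (Finset.mem_univ e₀), if_pos rfl]
  have h1 : e₁ ∈ univ.erase e₀ := Finset.mem_erase.2 ⟨hne.symm, Finset.mem_univ _⟩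
  rw [← Finset.mul_prod_erase _ _ h1, if_neg hne.symm, if_pos rfl, mul_assoc]
  congr 2
  rw [Finset.prod_congr rfl (fun e he => by
    rw [if_neg (Finset.ne_of_mem_erase (Finset.mem_of_mem_erase he)), if_neg (Finset.ne_of_mem_erase he)]),
    Finset.prod_const, Finset.card_erase_of_mem h1, Finset.card_erase_of_mem (Finset.mem_univ _), Finset.card_univ,
    Fintype.card_fin, Nat.sub_sub]

/-! ## Master identities -/

/-- The law times a function of pair `e₀`, summed: `Σ_u andLaw·f(pair e₀) = Σ_x π(x) f(x)` (1-wise uniformity at `e₀`). -/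
theorem sum_andLaw_mul_one {r : ℝ} (hr : 2 * r ^ 2 = 1) (A : Finset (Fin E → Bool)) (hA : A.Nonempty) (e₀ : Fin E)
    (hU : Unif1 A e₀) (f : Bool × Bool → ℝ) :
    ∑ u : Fin (E + E) → Bool, andLaw r A u * f (toPairs u e₀) = ∑ x : Bool × Bool, piW r x * f x := by
  classical
  set c : ℝ := (2 : ℝ) ^ E / A.card with hc
  have hstep : ∀ u : Fin (E + E) → Bool, andLaw r A u * f (toPairs u e₀) =
      c * (if andVec u ∈ A then ∏ e, (piW r (toPairs u e) * if e = e₀ then f (toPairs u e) else 1) else 0) := by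
    intro u
    rw [Finset.prod_mul_distrib, Finset.prod_ite_eq' univ e₀ (fun e => f (toPairs u e)), if_pos (Finset.mem_univ _)]
    unfold andLaw
    split_ifs with h
    · rw [wprod_eq]; simp only [piW]; ring
    · simp
  simp_rw [hstep]
  rw [← Finset.mul_sum, sum_andVec_prod A (fun e x => piW r x * if e = e₀ then f x else 1)]
  -- fibre sums: `F (α e₀)` at `e₀`, `1/2` elsewhere
  set F : Bool → ℝ := fun τ => ∑ x ∈ univ.filter (fun x : Bool × Bool => (x.1 && x.2) = τ), piW r x * f x with hF
  have hfib : ∀ α : Fin E → Bool, ∀ e : Fin E,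
      (∑ x ∈ univ.filter (fun x : Bool × Bool => (x.1 && x.2) = α e), piW r x * if e = e₀ then f x else 1) =
        if e = e₀ then F (α e₀) else 1 / 2 := by
    intro α e
    by_cases he : e = e₀
    · subst he; simp only [if_true, hF]
    · simp only [he, if_false, mul_one]; exact fibre_sum_piW hr _
  have hprod : ∀ α ∈ A, (∏ e, ∑ x ∈ univ.filter (fun x : Bool × Bool => (x.1 && x.2) = α e),
      piW r x * if e = e₀ then f x else 1) = F (α e₀) * (1 / 2) ^ (E - 1) := by
    intro α _
    rw [Finset.prod_congr rfl (fun e _ => hfib α e), prod_ite_one]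
  rw [Finset.sum_congr rfl hprod, ← Finset.sum_mul, sum_one_coord A e₀ hU F]
  have hE : E = (E - 1) + 1 := by have := e₀.isLt; omega
  have hAc : (A.card : ℝ) ≠ 0 := by exact_mod_cast hA.card_pos.ne'
  have hFF : F true + F false = ∑ x : Bool × Bool, piW r x * f x := fibre_sum_add r f
  have h2E : (2 : ℝ) ^ E = 2 ^ (E - 1) * 2 := by
    conv_lhs => rw [hE, pow_succ]
  have hhalf : ((1 : ℝ) / 2) ^ (E - 1) * 2 ^ (E - 1) = 1 := by rw [← mul_pow]; norm_num
  rw [hFF, hc, h2E]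
  field_simp
  linear_combination (∑ x, piW r x * f x) * hhalf

/-- The law times functions of two DIFFERENT pairs, summed: product of the pair sums (2-wise uniformity). -/
theorem sum_andLaw_mul_two {r : ℝ} (hr : 2 * r ^ 2 = 1) (A : Finset (Fin E → Bool)) (hA : A.Nonempty) {e₀ e₁ : Fin E}
    (hne : e₀ ≠ e₁) (hU : Unif2 A e₀ e₁) (f f' : Bool × Bool → ℝ) :
    ∑ u : Fin (E + E) → Bool, andLaw r A u * (f (toPairs u e₀) * f' (toPairs u e₁)) =
      (∑ x : Bool × Bool, piW r x * f x) * ∑ x : Bool × Bool, piW r x * f' x := by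
  classical
  set c : ℝ := (2 : ℝ) ^ E / A.card with hc
  have hstep : ∀ u : Fin (E + E) → Bool, andLaw r A u * (f (toPairs u e₀) * f' (toPairs u e₁)) =
      c * (if andVec u ∈ A then
        ∏ e, (piW r (toPairs u e) * if e = e₀ then f (toPairs u e) else if e = e₁ then f' (toPairs u e) else 1) else 0) := by
    intro u
    have : (∏ e, if e = e₀ then f (toPairs u e) else if e = e₁ then f' (toPairs u e) else (1 : ℝ)) =
        f (toPairs u e₀) * f' (toPairs u e₁) := by
      rw [← Finset.mul_prod_erase univ _ (Finset.mem_univ e₀), if_pos rfl]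
      have h1 : e₁ ∈ univ.erase e₀ := Finset.mem_erase.2 ⟨hne.symm, Finset.mem_univ _⟩
      rw [← Finset.mul_prod_erase _ _ h1, if_neg hne.symm, if_pos rfl]
      rw [Finset.prod_eq_one (fun e he => by
        rw [if_neg (Finset.ne_of_mem_erase (Finset.mem_of_mem_erase he)), if_neg (Finset.ne_of_mem_erase he)])]
      ring
    rw [Finset.prod_mul_distrib, this]
    unfold andLaw
    split_ifs with h
    · rw [wprod_eq]; simp only [piW]; ring
    · simp
  simp_rw [hstep]
  rw [← Finset.mul_sum, sum_andVec_prod A (fun e x => piW r x * if e = e₀ then f x else if e = e₁ then f' x else 1)]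
  set F : Bool → ℝ := fun τ => ∑ x ∈ univ.filter (fun x : Bool × Bool => (x.1 && x.2) = τ), piW r x * f x with hF
  set F' : Bool → ℝ := fun τ => ∑ x ∈ univ.filter (fun x : Bool × Bool => (x.1 && x.2) = τ), piW r x * f' x with hF'
  have hfib : ∀ α : Fin E → Bool, ∀ e : Fin E,
      (∑ x ∈ univ.filter (fun x : Bool × Bool => (x.1 && x.2) = α e),
        piW r x * if e = e₀ then f x else if e = e₁ then f' x else 1) =
        if e = e₀ then F (α e₀) else if e = e₁ then F' (α e₁) else 1 / 2 := by
    intro α e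
    by_cases he : e = e₀
    · subst he; simp only [if_true, hF]
    · by_cases he' : e = e₁
      · subst he'; simp only [he, if_false, if_true, hF']
      · simp only [he, he', if_false, mul_one]; exact fibre_sum_piW hr _
  have hprod : ∀ α ∈ A, (∏ e, ∑ x ∈ univ.filter (fun x : Bool × Bool => (x.1 && x.2) = α e),
      piW r x * if e = e₀ then f x else if e = e₁ then f' x else 1) = F (α e₀) * F' (α e₁) * (1 / 2) ^ (E - 2) := by
    intro α _
    rw [Finset.prod_congr rfl (fun e _ => hfib α e), prod_ite_two hne]
  rw [Finset.sum_congr rfl hprod, ← Finset.sum_mul, sum_two_coord A e₀ e₁ hU F F']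
  have hE : E = (E - 2) + 2 := by
    have h0 := e₀.isLt; have h1 := e₁.isLt
    have : e₀.val ≠ e₁.val := fun h => hne (Fin.ext h)
    omega
  have hAc : (A.card : ℝ) ≠ 0 := by exact_mod_cast hA.card_pos.ne'
  have h2E : (2 : ℝ) ^ E = 2 ^ (E - 2) * 2 ^ 2 := by
    conv_lhs => rw [hE, pow_add]
  have hhalf : ((1 : ℝ) / 2) ^ (E - 2) * 2 ^ (E - 2) = 1 := by rw [← mul_pow]; norm_num
  rw [fibre_sum_add r f, fibre_sum_add r f', hc, h2E]
  field_simp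
  linear_combination (4 * ((∑ x, piW r x * f x) * ∑ x, piW r x * f' x)) * hhalf

/-! ## Total mass, marginals, pairwise independence -/

/-- Pair sums of indicator-weighted `piW`: first slot. -/
theorem sum_piW_fst (r : ℝ) (β : Bool) : ∑ x : Bool × Bool, piW r x * (if x.1 = β then 1 else 0) = rho r β := by
  cases β <;> simp [Fintype.sum_prod_type, piW, rho] <;> ring

/-- Pair sums of indicator-weighted `piW`: second slot. -/
theorem sum_piW_snd (r : ℝ) (β : Bool) : ∑ x : Bool × Bool, piW r x * (if x.2 = β then 1 else 0) = rho r β := by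
  cases β <;> simp [Fintype.sum_prod_type, piW, rho] <;> ring

/-- Pair sums of indicator-weighted `piW`: both slots. -/
theorem sum_piW_both (r : ℝ) (β β' : Bool) :
    ∑ x : Bool × Bool, piW r x * (if x.1 = β ∧ x.2 = β' then 1 else 0) = rho r β * rho r β' := by
  cases β <;> cases β' <;> simp [Fintype.sum_prod_type, piW, rho]

/-- **Total mass `1`.** -/
theorem andLaw_total {r : ℝ} (hr : 2 * r ^ 2 = 1) (A : Finset (Fin E → Bool)) (hA : A.Nonempty) (hE : 0 < E)
    (hU : ∀ e, Unif1 A e) : ∑ u : Fin (E + E) → Bool, andLaw r A u = 1 := by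
  have h := sum_andLaw_mul_one hr A hA ⟨0, hE⟩ (hU _) (fun _ => 1)
  simp only [mul_one] at h
  rw [h]
  have : ∑ x : Bool × Bool, piW r x = (∑ x ∈ univ.filter (fun x : Bool × Bool => (x.1 && x.2) = true), piW r x) +
      ∑ x ∈ univ.filter (fun x : Bool × Bool => (x.1 && x.2) = false), piW r x := by
    have := fibre_sum_add r (fun _ => 1); simp only [mul_one] at this; exact this.symm
  rw [this, fibre_sum_piW hr, fibre_sum_piW hr]; norm_num

/-- **Slot marginals are `ρ_r`.** -/
theorem marg1_andLaw {r : ℝ} (hr : 2 * r ^ 2 = 1) (A : Finset (Fin E → Bool)) (hA : A.Nonempty) (hU : ∀ e, Unif1 A e)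
    (s : Fin (E + E)) (β : Bool) : marg1 (andLaw r A) s β = rho r β := by
  unfold PairwiseSALevel.marg1
  induction s using Fin.addCases with
  | left e₀ =>
      have h := sum_andLaw_mul_one hr A hA e₀ (hU e₀) (fun x => if x.1 = β then 1 else 0)
      rw [sum_piW_fst] at h
      rw [← h]
      refine Finset.sum_congr rfl fun u _ => ?_
      simp only [toPairs]
      split_ifs <;> simp
  | right e₀ =>
      have h := sum_andLaw_mul_one hr A hA e₀ (hU e₀) (fun x => if x.2 = β then 1 else 0)
      rw [sum_piW_snd] at h
      rw [← h]
      refine Finset.sum_congr rfl fun u _ => ?_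
      simp only [toPairs]
      split_ifs <;> simp

/-- **Pair marginals factor**: `marg2 = ρ_r(β)·ρ_r(β')` for distinct slots (1-wise uniformity for the two slots of one pair,
2-wise uniformity across pairs). -/
theorem marg2_andLaw {r : ℝ} (hr : 2 * r ^ 2 = 1) (A : Finset (Fin E → Bool)) (hA : A.Nonempty) (hU : ∀ e, Unif1 A e)
    (hU2 : ∀ e e', e ≠ e' → Unif2 A e e') (s s' : Fin (E + E)) (hss : s ≠ s') (β β' : Bool) :
    marg2 (andLaw r A) s s' β β' = rho r β * rho r β' := by
  unfold PairwiseSALevel.marg2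
  induction s using Fin.addCases with
  | left e₀ =>
    induction s' using Fin.addCases with
    | left e₁ =>
        have hne : e₀ ≠ e₁ := fun h => hss (by rw [h])
        have h := sum_andLaw_mul_two hr A hA hne (hU2 _ _ hne) (fun x => if x.1 = β then 1 else 0)
          (fun x => if x.1 = β' then 1 else 0)
        rw [sum_piW_fst, sum_piW_fst] at h
        rw [← h]
        refine Finset.sum_congr rfl fun u _ => ?_
        simp only [toPairs]
        split_ifs <;> simp_all
    | right e₁ =>
        by_cases hne : e₀ = e₁
        · subst hne
          have h := sum_andLaw_mul_one hr A hA e₀ (hU e₀) (fun x => if x.1 = β ∧ x.2 = β' then 1 else 0)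
          rw [sum_piW_both] at h
          rw [← h]
          refine Finset.sum_congr rfl fun u _ => ?_
          simp only [toPairs]
          split_ifs <;> simp_all
        · have h := sum_andLaw_mul_two hr A hA hne (hU2 _ _ hne) (fun x => if x.1 = β then 1 else 0)
            (fun x => if x.2 = β' then 1 else 0)
          rw [sum_piW_fst, sum_piW_snd] at h
          rw [← h]
          refine Finset.sum_congr rfl fun u _ => ?_
          simp only [toPairs]
          split_ifs <;> simp_all
  | right e₀ =>
    induction s' using Fin.addCases with
    | left e₁ =>
        by_cases hne : e₀ = e₁
        · subst hne
          have h := sum_andLaw_mul_one hr A hA e₀ (hU e₀) (fun x => if x.1 = β' ∧ x.2 = β then 1 else 0)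
          rw [sum_piW_both] at h
          rw [mul_comm, ← h]
          refine Finset.sum_congr rfl fun u _ => ?_
          simp only [toPairs]
          split_ifs <;> simp_all
        · have h := sum_andLaw_mul_two hr A hA hne (hU2 _ _ hne) (fun x => if x.2 = β then 1 else 0)
            (fun x => if x.1 = β' then 1 else 0)
          rw [sum_piW_snd, sum_piW_fst] at h
          rw [← h]
          refine Finset.sum_congr rfl fun u _ => ?_
          simp only [toPairs]
          split_ifs <;> simp_all
    | right e₁ =>
        have hne : e₀ ≠ e₁ := fun h => hss (by rw [h])
        have h := sum_andLaw_mul_two hr A hA hne (hU2 _ _ hne) (fun x => if x.2 = β then 1 else 0)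
          (fun x => if x.2 = β' then 1 else 0)
        rw [sum_piW_snd, sum_piW_snd] at h
        rw [← h]
        refine Finset.sum_congr rfl fun u _ => ?_
        simp only [toPairs]
        split_ifs <;> simp_all

end Summit.PneNP.PneNP.Theorems.AffineAndLawsMarginals
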